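import Summits.AtomisticToContinuum.Crystallization.Theses.ChessboardParticlePlanes
import Summits.AtomisticToContinuum.Crystallization.Theorems.ChessboardParticlePlanesLjBilayerHcpStubPresentation

/-!
# Crux `LjPlaneChessboard` (stmt-AtomisticToContinuum-6709), line `Sketch`,
# stub `stub_restackEnergy`

The LAYER-ADAPTED ENERGY FORMULA for the period-2 restack of two occupied layers.

Let `Q` be a periodic configuration of `ℝ³` whose periods `g ∈ G = Q.lattice` have heights
`g 2 ∈ c₀ℤ` (`c₀ > 0` the height of a period), let `t < t'` be two occupied heights and let `B` be
ANY periodic configuration whose point set is the restack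
`R(t,t') = {x + 2(t'−t)k e₃ : x ∈ Q.points, x₂ ∈ {t, t'}, k ∈ ℤ}`.  With `F_t` (`F_{t'}`) the motif
points of `Q` whose height lies in `t + c₀ℤ` (`t' + c₀ℤ`), `rep x ∈ Q.points` a `G`-translate of
`x ∈ F_t` at height exactly `t` (`rep' x` at height `t'` for `x ∈ F_{t'}`), and the site sum
`h(p) = ∑' y ∈ R(t,t') ∖ {p}, V |p − y|`:

  `2 (#F_t + #F_{t'}) · e(B) = Σ_{x ∈ F_t} h(rep x) + Σ_{x ∈ F_{t'}} h(rep' x)`.  [folklore]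

PROOF.
1. `restackEnergy_exists_lattice`: `L := Λ₀ ⊕ ℤ · 2(t'−t)e₃`, `Λ₀ = G ∩ {x₂ = 0}`, is a discrete
   full-rank lattice: a vector `g₀ + 2(t'−t)k e₃` of `L` of norm `< min(ε_G, 2(t'−t))` has `k = 0`
   (coordinate `2`) and then `g₀ = 0` (`ε_G` the norm gap of the discrete `G`); it spans `ℝ³`:
   every `g ∈ G` is `(g − k w) + k w` with `g − k w ∈ Λ₀` (`w ∈ G` a period of height `c₀`,
   `g₂ = c₀ k`), so `ℝ³ = span_ℝ G ⊆ span_ℝ Λ₀ + ℝ w`, and a horizontal vector `v₀ + r w`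
   (`v₀ ∈ span_ℝ Λ₀`) has `r c₀ = 0`, i.e. lies in `span_ℝ Λ₀`; with `e₃ ∈ span_ℝ L` this is all
   of `ℝ³`.
2. `M := rep(F_t) ∪ rep'(F_{t'})` is a transversal of `R(t,t')` modulo `L`: a point of `R` is
   `y + 2(t'−t)k e₃` with `y = x + g ∈ Q.points` at height `t` (say), `x ∈ Q.motif`, so `x ∈ F_t`
   and `y − rep x ∈ G` has height `0`, i.e. lies in `Λ₀`; two points of `M` congruent modulo `L`
   have the same height (`±(t'−t) ∉ 2(t'−t)ℤ ∖ {0}`), hence are congruent modulo `Λ₀ ⊆ G`, so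
   their motif points are congruent modulo `G` and coincide (`Q.eq_of_sub_mem`).  The same
   argument makes `rep` injective on `F_t`, `rep'` injective on `F_{t'}`, with disjoint images
   (heights `t ≠ t'`).
3. `restackEnergy_formula_of_transversal`: `(L, M)` is a second presentation `B'` of `R(t,t')`, so
   `e(B) = e(B') = (2 #M)⁻¹ Σ_{m ∈ M} h(m)` because the energy per particle depends only on the
   point set (`stub_pointsCongr`, p105939, i.e. the sibling crux's
   `LjBilayerHcpSketch.presentation_energy_eq_of_points_eq`, which is called directly); finally
   `#M = #F_t + #F_{t'}` and `Σ_M h = Σ_{F_t} h ∘ rep + Σ_{F_{t'}} h ∘ rep'`.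

No definition is introduced (the second presentation is an anonymous structure instance).  The
file depends only on the route file and on the sibling crux's presentation lemma
(`Theorems/ChessboardParticlePlanesLjBilayerHcpStubPresentation.lean`); the horizontal periods of
`stub_planarPeriods` (p104404) are not needed, full rank being read off from `span_ℝ G = ℝ³`.
-/

noncomputable section

namespace Summit.AtomisticToContinuum.Crystallization.Theorems.ChessboardParticlePlanesLjPlaneChessboard

open Literature.MathematicalPhysics.StatisticalMechanics

/-- **The lattice of the restack.**  If `G` is a full-rank discrete lattice of `ℝ³` whose
heights `g₂`, `g ∈ G`, form the cyclic group `c₀ℤ` (`c₀ ≠ 0` the height of some `w ∈ G`), and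
`c ≠ 0`, then `L = (G ∩ {x₂ = 0}) ⊕ ℤ · c e₃ = {g + c k e₃ : g ∈ G, g₂ = 0, k ∈ ℤ}` is a discrete
subgroup of full rank: a vector of `L` of norm `< min (ε_G, |c|)` (`ε_G` the norm gap of `G`) has
`k = 0` by its coordinate `2` and then vanishes; and `span_ℝ L = ℝ³` because
`ℝ³ = span_ℝ G ⊆ span_ℝ Λ₀ + ℝ w` (`g = (g − k w) + k w`, `g − k w ∈ Λ₀ = G ∩ {x₂ = 0}`), so every
horizontal vector `v₀ + r w` has `r c₀ = 0` and lies in `span_ℝ Λ₀ ⊆ span_ℝ L`, while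
`e₃ ∈ span_ℝ L`. [folklore] -/
theorem restackEnergy_exists_lattice (G : Submodule ℤ (EuclideanSpace ℝ (Fin 3)))
    [DiscreteTopology G] [hGz : IsZLattice ℝ G] {c₀ : ℝ} (hc₀ : c₀ ≠ 0)
    (hw : ∃ w ∈ G, w 2 = c₀) (hG : ∀ g ∈ G, ∃ k : ℤ, g 2 = c₀ * k) {c : ℝ} (hc : c ≠ 0) :
    ∃ L : Submodule ℤ (EuclideanSpace ℝ (Fin 3)), ∃ _ : DiscreteTopology L, IsZLattice ℝ L ∧
      ∀ l, l ∈ L ↔ ∃ g ∈ G, g 2 = 0 ∧ ∃ k : ℤ,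
        l = g + (c * (k : ℝ)) • EuclideanSpace.single (2 : Fin 3) (1 : ℝ) := by
  set e : EuclideanSpace ℝ (Fin 3) := EuclideanSpace.single (2 : Fin 3) (1 : ℝ) with he
  -- the subgroup `Λ₀ ⊕ ℤ (c • e)`, `Λ₀ = G ∩ {x₂ = 0}`
  let L₀ : AddSubgroup (EuclideanSpace ℝ (Fin 3)) :=
    { carrier := {l | ∃ g ∈ G, g 2 = 0 ∧ ∃ k : ℤ, l = g + (c * (k : ℝ)) • e}
      add_mem' := by
        rintro _ _ ⟨g, hg, hg2, k, rfl⟩ ⟨g', hg', hg'2, k', rfl⟩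
        refine ⟨g + g', G.add_mem hg hg', by simp [hg2, hg'2], k + k', ?_⟩
        push_cast
        module
      zero_mem' := ⟨0, G.zero_mem, rfl, 0, by simp⟩
      neg_mem' := by
        rintro _ ⟨g, hg, hg2, k, rfl⟩
        refine ⟨-g, G.neg_mem hg, by simp [hg2], -k, ?_⟩
        push_cast
        module }
  let L : Submodule ℤ (EuclideanSpace ℝ (Fin 3)) := AddSubgroup.toIntSubmodule L₀
  have hmem : ∀ l, l ∈ L ↔ ∃ g ∈ G, g 2 = 0 ∧ ∃ k : ℤ, l = g + (c * (k : ℝ)) • e :=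
    fun l => Iff.rfl
  have happ : ∀ (g : EuclideanSpace ℝ (Fin 3)) (r : ℝ), (g + r • e) 2 = g 2 + r := fun g r => by
    simp [he]
  -- discreteness: the norm gap `min ε |c|`
  have hd : DiscreteTopology L := by
    obtain ⟨ε, hε, hεG⟩ : ∃ ε > 0, ∀ g ∈ G, ‖g‖ < ε → g = 0 := by
      have h1 : IsOpen ({0} : Set G) := isOpen_discrete _
      rw [Metric.isOpen_singleton_iff] at h1
      obtain ⟨ε, hε, h⟩ := h1
      refine ⟨ε, hε, fun g hg hgε => ?_⟩
      have h2 := h ⟨g, hg⟩ (by rwa [dist_zero_right])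
      exact congrArg Subtype.val h2
    rw [discreteTopology_iff_isOpen_singleton_zero, Metric.isOpen_singleton_iff]
    refine ⟨min ε |c|, lt_min hε (abs_pos.2 hc), ?_⟩
    rintro ⟨l, hl⟩ hlt
    obtain ⟨g, hg, hg2, k, rfl⟩ := (hmem l).1 hl
    rw [dist_zero_right] at hlt
    change ‖g + (c * (k : ℝ)) • e‖ < min ε |c| at hlt
    have h2 : |c * (k : ℝ)| < |c| := by
      have h3 := PiLp.norm_apply_le (g + (c * (k : ℝ)) • e) 2
      rw [happ, hg2, zero_add, Real.norm_eq_abs] at h3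
      exact h3.trans_lt (hlt.trans_le (min_le_right _ _))
    have hk : k = 0 := by
      rw [abs_mul, mul_lt_iff_lt_one_right (abs_pos.2 hc)] at h2
      have h4 : |k| < 1 := by exact_mod_cast h2
      exact Int.abs_lt_one_iff.1 h4
    subst hk
    have hg0 : g = 0 := hεG g hg (by
      have : g + (c * ((0 : ℤ) : ℝ)) • e = g := by simp
      rw [this] at hlt
      exact hlt.trans_le (min_le_left _ _))
    subst hg0
    ext1
    simp
  refine ⟨L, hd, ⟨?_⟩, hmem⟩
  -- full rank
  obtain ⟨w, hw, hw2⟩ := hw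
  have he2 : e 2 = 1 := by simp [he]
  -- the `ℝ`-span `S₀` of `Λ₀ = G ∩ {x₂ = 0}` lies in `span_ℝ L` and in the horizontal plane
  set S₀ : Submodule ℝ (EuclideanSpace ℝ (Fin 3)) :=
    Submodule.span ℝ {g | g ∈ G ∧ g 2 = 0} with hS₀
  have hS₀L : S₀ ≤ Submodule.span ℝ (L : Set (EuclideanSpace ℝ (Fin 3))) :=
    Submodule.span_mono fun g hg => (hmem g).2 ⟨g, hg.1, hg.2, 0, by simp⟩
  have hS₀2 : ∀ v ∈ S₀, v 2 = 0 := by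
    intro v hv
    have hker : S₀ ≤ LinearMap.ker
        ((EuclideanSpace.proj (2 : Fin 3) : EuclideanSpace ℝ (Fin 3) →L[ℝ] ℝ) :
          EuclideanSpace ℝ (Fin 3) →ₗ[ℝ] ℝ) :=
      Submodule.span_le.2 fun g hg => hg.2
    exact hker hv
  -- `span_ℝ G ≤ S₀ + ℝ w`: `g = (g - k w) + k w` with `g - k w ∈ Λ₀`
  have hGle : Submodule.span ℝ (G : Set (EuclideanSpace ℝ (Fin 3))) ≤ S₀ ⊔ ℝ ∙ w := by
    rw [Submodule.span_le]
    intro g hg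
    obtain ⟨k, hk⟩ := hG g hg
    refine Submodule.mem_sup.2 ⟨g - (k : ℝ) • w, Submodule.subset_span ⟨?_, ?_⟩, (k : ℝ) • w,
      Submodule.mem_span_singleton.2 ⟨k, rfl⟩, sub_add_cancel _ _⟩
    · rw [Int.cast_smul_eq_zsmul]
      exact G.sub_mem hg (zsmul_mem hw k)
    · rw [PiLp.sub_apply, PiLp.smul_apply, hk, hw2, smul_eq_mul, mul_comm, sub_self]
  rw [eq_top_iff]
  rintro x -
  -- `e ∈ span_ℝ L` (as `c⁻¹ (c e)`), and the horizontal part `x - x₂ e` lies in `S₀`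
  have heL : e ∈ Submodule.span ℝ (L : Set (EuclideanSpace ℝ (Fin 3))) := by
    have h1 : c • e ∈ Submodule.span ℝ (L : Set (EuclideanSpace ℝ (Fin 3))) :=
      Submodule.subset_span ((hmem _).2 ⟨0, G.zero_mem, rfl, 1, by simp⟩)
    have h2 := Submodule.smul_mem _ c⁻¹ h1
    rwa [smul_smul, inv_mul_cancel₀ hc, one_smul] at h2
  have hh : x - (x 2) • e ∈ Submodule.span ℝ (L : Set (EuclideanSpace ℝ (Fin 3))) := by
    have hxG : x - (x 2) • e ∈ Submodule.span ℝ (G : Set (EuclideanSpace ℝ (Fin 3))) := by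
      rw [hGz.span_top]
      trivial
    obtain ⟨v₀, hv₀, _, hr, hsum⟩ := Submodule.mem_sup.1 (hGle hxG)
    obtain ⟨r, rfl⟩ := Submodule.mem_span_singleton.1 hr
    have h2 := congrArg (fun z : EuclideanSpace ℝ (Fin 3) => z 2) hsum
    simp only [PiLp.add_apply, PiLp.smul_apply, PiLp.sub_apply, hw2, hS₀2 v₀ hv₀, he2,
      smul_eq_mul, mul_one, sub_self, zero_add] at h2
    have hr0 : r = 0 := (mul_eq_zero.1 h2).resolve_right hc₀
    rw [hr0, zero_smul, add_zero] at hsum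
    rw [← hsum]
    exact hS₀L hv₀
  rw [← sub_add_cancel x ((x 2) • e)]
  exact Submodule.add_mem _ hh (Submodule.smul_mem _ _ heL)

/-- **The energy per particle over a transversal.**  If a finite non-empty set `M ⊂ ℝ³` of points
pairwise inequivalent modulo a discrete full-rank lattice `L` generates the point set of the
periodic configuration `B`, `B.points = M + L`, then `(L, M)` is a second presentation of that
point set and `2 #M · e(B) = Σ_{m ∈ M} ∑' y ∈ B.points ∖ {m}, V |m − y|` (the energy per particle
depends only on the point set: `stub_pointsCongr`, p105939, alias of the sibling crux's
`LjBilayerHcpSketch.presentation_energy_eq_of_points_eq`). [folklore] -/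
theorem restackEnergy_formula_of_transversal (B : PeriodicConfiguration 3) (V : ℝ → ℝ)
    (L : Submodule ℤ (EuclideanSpace ℝ (Fin 3))) [DiscreteTopology L] [IsZLattice ℝ L]
    (M : Finset (EuclideanSpace ℝ (Fin 3))) (hne : M.Nonempty)
    (huniq : ∀ x ∈ M, ∀ y ∈ M, x - y ∈ L → x = y)
    (hpts : B.points = {z | ∃ y ∈ M, ∃ g ∈ L, z = y + g}) :
    2 * (M.card : ℝ) * B.energyPerParticle V =
      ∑ m ∈ M, ∑' y : {y : EuclideanSpace ℝ (Fin 3) // y ∈ B.points ∧ y ≠ m},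
        V (dist m y.1) := by
  -- the second presentation `(L, M)` of the point set of `B`
  let B' : PeriodicConfiguration 3 :=
    { lattice := L, discrete := ‹_›, isZLattice := ‹_›, motif := M, motif_nonempty := hne,
      eq_of_sub_mem := huniq }
  have h' : B.points = B'.points := hpts
  have e' : B'.energyPerParticle V = (2 * (M.card : ℝ))⁻¹ *
      ∑ m ∈ M, ∑' y : {y : EuclideanSpace ℝ (Fin 3) // y ∈ B'.points ∧ y ≠ m},
        V (dist m y.1) := rfl
  have hM0 : (2 * (M.card : ℝ)) ≠ 0 :=
    mul_ne_zero two_ne_zero (by exact_mod_cast (Finset.card_pos.2 hne).ne')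
  rw [LjBilayerHcpSketch.presentation_energy_eq_of_points_eq V B B' h', e', ← h', ← mul_assoc,
    mul_inv_cancel₀ hM0, one_mul]

/-- **Stub 9 — layer-adapted energy formula for a restack (L).**  Let the heights of the periods
of `Q` lie in `c₀ℤ`, `c₀ > 0` the height of a period.  For occupied heights `t < t'` and ANY
periodic configuration `B` whose point set is the restack `R(t,t')`, the energy per particle of
`B` is the average of the site sums of `R(t,t')` over the LAYER-ADAPTED transversal
`{rep x : x ∈ F_t} ∪ {rep' x : x ∈ F_{t'}}`: here `F_t` (`F_{t'}`) are the motif points of `Q`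
whose height lies in `t + c₀ℤ` (`t' + c₀ℤ`), and `rep x ∈ Q.points` is a `G`-translate of `x` at
height exactly `t` (`rep' x` at height `t'`).  Proof: `Λ₀ ⊕ ℤ·2(t'−t)e₃` (`Λ₀ = G ∩ {x₂ = 0}`) is
a full-rank discrete lattice of periods of `R(t,t')` (`restackEnergy_exists_lattice`), the
displayed set is a transversal of `R(t,t')` modulo it (a point of the layer `t` is `x + g`,
`x ∈ F_t`, and then `≡ rep x (mod Λ₀)`; inequivalence from that of `F` modulo `G` and from the
heights `t ≢ t' (mod 2(t'−t))`), so it is the motif of a second presentation of `R(t,t')` with the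
same energy per particle (`stub_pointsCongr` p105939, through
`restackEnergy_formula_of_transversal`); `rep` is injective on `F_t`, `rep'` on `F_{t'}`, and the
two images are disjoint. [folklore] -/
theorem stub_restackEnergy :
    ∀ (Q : PeriodicConfiguration 3) (c₀ t t' : ℝ) (B : PeriodicConfiguration 3)
      (Ft Ft' : Finset (EuclideanSpace ℝ (Fin 3)))
      (rep rep' : EuclideanSpace ℝ (Fin 3) → EuclideanSpace ℝ (Fin 3)) (V : ℝ → ℝ),
      (∀ x ∈ Q.points, ∀ y ∈ Q.points, x 2 ≠ y 2 → (3 : ℝ) / 4 ≤ |x 2 - y 2|) →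
      0 < c₀ → (∃ g ∈ Q.lattice, g 2 = c₀) → (∀ g ∈ Q.lattice, ∃ k : ℤ, g 2 = c₀ * k) →
      t < t' → (∃ x ∈ Q.points, x 2 = t) → (∃ x ∈ Q.points, x 2 = t') →
      (∀ x, x ∈ Ft ↔ x ∈ Q.motif ∧ ∃ k : ℤ, x 2 = t + c₀ * k) →
      (∀ x, x ∈ Ft' ↔ x ∈ Q.motif ∧ ∃ k : ℤ, x 2 = t' + c₀ * k) →
      (∀ x ∈ Ft, rep x ∈ Q.points ∧ rep x 2 = t ∧ x - rep x ∈ Q.lattice) →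
      (∀ x ∈ Ft', rep' x ∈ Q.points ∧ rep' x 2 = t' ∧ x - rep' x ∈ Q.lattice) →
      B.points = {p : EuclideanSpace ℝ (Fin 3) | ∃ k : ℤ, ∃ x ∈ Q.points, (x 2 = t ∨ x 2 = t') ∧
        p = x + ((2 * (t' - t)) * (k : ℝ)) • EuclideanSpace.single (2 : Fin 3) (1 : ℝ)} →
      2 * ((Ft.card : ℝ) + (Ft'.card : ℝ)) * B.energyPerParticle V =
        (∑ x ∈ Ft, ∑' y : {y : EuclideanSpace ℝ (Fin 3) // y ∈ B.points ∧ y ≠ rep x},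
            V (dist (rep x) y.1)) +
        (∑ x ∈ Ft', ∑' y : {y : EuclideanSpace ℝ (Fin 3) // y ∈ B.points ∧ y ≠ rep' x},
            V (dist (rep' x) y.1)) := by
  intro Q c₀ t t' B Ft Ft' rep rep' V _ hc₀ hw hG htt ht _ hFt hFt' hrep hrep' hB
  classical
  -- the vertical period `c • e`, `c = 2 (t' - t) ≠ 0`; heights of vertical translates
  set e : EuclideanSpace ℝ (Fin 3) := EuclideanSpace.single (2 : Fin 3) (1 : ℝ) with he
  set c : ℝ := 2 * (t' - t) with hc
  have hc0 : c ≠ 0 := mul_ne_zero two_ne_zero (sub_ne_zero.2 htt.ne')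
  have happ : ∀ (g : EuclideanSpace ℝ (Fin 3)) (r : ℝ), (g + r • e) 2 = g 2 + r := fun g r => by
    simp [he]
  -- the lattice `L = Λ₀ ⊕ ℤ (c • e)` of the restack
  obtain ⟨L, hLd, hLz, hL⟩ := restackEnergy_exists_lattice Q.lattice hc₀.ne' hw hG hc0
  -- the height class of a motif point is read off from any of its translates
  have hclass : ∀ x ∈ Q.motif, ∀ g ∈ Q.lattice, ∀ s : ℝ, (x + g) 2 = s →
      ∃ k : ℤ, x 2 = s + c₀ * k := by
    intro x _ g hg s hs
    obtain ⟨k, hk⟩ := hG g hg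
    refine ⟨-k, ?_⟩
    rw [PiLp.add_apply, hk] at hs
    push_cast
    linarith
  -- the layer-adapted transversal `M = rep(Ft) ∪ rep'(Ft')`
  obtain ⟨M, hM⟩ : ∃ M : Finset (EuclideanSpace ℝ (Fin 3)), M = Ft.image rep ∪ Ft'.image rep' :=
    ⟨_, rfl⟩
  have hmemM : ∀ m, m ∈ M ↔ (∃ x ∈ Ft, rep x = m) ∨ (∃ x ∈ Ft', rep' x = m) := fun m => by
    rw [hM, Finset.mem_union, Finset.mem_image, Finset.mem_image]
  -- `rep` is injective on `Ft`, `rep'` on `Ft'`, and the two images are disjoint (heights)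
  have hinj : Set.InjOn rep Ft := by
    intro x hx x' hx' hxx'
    refine Q.eq_of_sub_mem x ((hFt x).1 hx).1 x' ((hFt x').1 hx').1 ?_
    have h1 : x - x' = (x - rep x) - (x' - rep x') := by rw [hxx']; abel
    rw [h1]
    exact Q.lattice.sub_mem (hrep x hx).2.2 (hrep x' hx').2.2
  have hinj' : Set.InjOn rep' Ft' := by
    intro x hx x' hx' hxx'
    refine Q.eq_of_sub_mem x ((hFt' x).1 hx).1 x' ((hFt' x').1 hx').1 ?_
    have h1 : x - x' = (x - rep' x) - (x' - rep' x') := by rw [hxx']; abel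
    rw [h1]
    exact Q.lattice.sub_mem (hrep' x hx).2.2 (hrep' x' hx').2.2
  have hdisj : Disjoint (Ft.image rep) (Ft'.image rep') := by
    rw [Finset.disjoint_left]
    intro p hp hp'
    obtain ⟨x, hx, rfl⟩ := Finset.mem_image.1 hp
    obtain ⟨x', hx', hxx'⟩ := Finset.mem_image.1 hp'
    have h1 := (hrep x hx).2.1
    have h2 := (hrep' x' hx').2.1
    rw [hxx', h1] at h2
    exact absurd h2 htt.ne
  -- points of `M` are points of `Q` at height `t` or `t'`
  have hMpts : ∀ m ∈ M, m ∈ Q.points ∧ (m 2 = t ∨ m 2 = t') := by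
    intro m hm
    rcases (hmemM m).1 hm with ⟨x, hx, rfl⟩ | ⟨x, hx, rfl⟩
    · exact ⟨(hrep x hx).1, Or.inl (hrep x hx).2.1⟩
    · exact ⟨(hrep' x hx).1, Or.inr (hrep' x hx).2.1⟩
  -- two points of `M` at the same height and congruent modulo `G` coincide (the motif is a
  -- transversal of `Q.points` modulo `G`)
  have hkey : ∀ m ∈ M, ∀ m' ∈ M, m 2 = m' 2 → m - m' ∈ Q.lattice → m = m' := by
    intro m hm m' hm' h2 hG'
    rcases (hmemM m).1 hm with ⟨x, hx, rfl⟩ | ⟨x, hx, rfl⟩ <;>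
      rcases (hmemM m').1 hm' with ⟨x', hx', rfl⟩ | ⟨x', hx', rfl⟩
    · have hxx' : x - x' ∈ Q.lattice := by
        have h1 : x - x' = (x - rep x) + (rep x - rep x') - (x' - rep x') := by abel
        rw [h1]
        exact Q.lattice.sub_mem (Q.lattice.add_mem (hrep x hx).2.2 hG') (hrep x' hx').2.2
      rw [Q.eq_of_sub_mem x ((hFt x).1 hx).1 x' ((hFt x').1 hx').1 hxx']
    · exact absurd (((hrep x hx).2.1).symm.trans (h2.trans (hrep' x' hx').2.1)) htt.ne
    · exact absurd (((hrep x' hx').2.1).symm.trans (h2.symm.trans (hrep' x hx).2.1)) htt.ne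
    · have hxx' : x - x' ∈ Q.lattice := by
        have h1 : x - x' = (x - rep' x) + (rep' x - rep' x') - (x' - rep' x') := by abel
        rw [h1]
        exact Q.lattice.sub_mem (Q.lattice.add_mem (hrep' x hx).2.2 hG') (hrep' x' hx').2.2
      rw [Q.eq_of_sub_mem x ((hFt' x).1 hx).1 x' ((hFt' x').1 hx').1 hxx']
  -- (i) `M` is non-empty: the occupied height `t` yields a motif point in the class of `t`
  have hne : M.Nonempty := by
    obtain ⟨_, ⟨y, hy, g, hg, rfl⟩, hyt⟩ := ht
    have hyFt : y ∈ Ft := (hFt y).2 ⟨hy, hclass y hy g hg t hyt⟩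
    exact ⟨rep y, (hmemM _).2 (Or.inl ⟨y, hyFt, rfl⟩)⟩
  -- (ii) points of `M` are pairwise inequivalent modulo `L`
  have huniq : ∀ m ∈ M, ∀ m' ∈ M, m - m' ∈ L → m = m' := by
    intro m hm m' hm' hmm'
    obtain ⟨g₀, hg₀, hg₀2, k, hk⟩ := (hL _).1 hmm'
    have hdiff : m 2 - m' 2 = c * k := by
      rw [← PiLp.sub_apply, hk, happ, hg₀2, zero_add]
    have hk0 : k = 0 := by
      by_contra hk0
      have h1 : (1 : ℝ) ≤ |(k : ℝ)| := by exact_mod_cast Int.one_le_abs hk0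
      have h3 : |m 2 - m' 2| ≤ t' - t := by
        obtain ⟨-, h | h⟩ := hMpts m hm <;> obtain ⟨-, h' | h'⟩ := hMpts m' hm' <;>
          rw [h, h', abs_le] <;> constructor <;> linarith
      rw [hdiff, abs_mul, hc, abs_of_pos (by linarith : (0 : ℝ) < 2 * (t' - t))] at h3
      nlinarith
    rw [hk0, Int.cast_zero, mul_zero] at hdiff
    rw [hk0, Int.cast_zero, mul_zero, zero_smul, add_zero] at hk
    exact hkey m hm m' hm' (sub_eq_zero.1 hdiff) (hk ▸ hg₀)
  -- (iii) the restack is the point set `M + L`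
  have hpts : B.points = {z | ∃ y ∈ M, ∃ g ∈ L, z = y + g} := by
    rw [hB]
    ext p
    constructor
    · rintro ⟨k, _, ⟨x, hx, g, hg, rfl⟩, hxt, rfl⟩
      rcases hxt with hxt | hxt
      · have hxF : x ∈ Ft := (hFt x).2 ⟨hx, hclass x hx g hg t hxt⟩
        refine ⟨rep x, (hmemM _).2 (Or.inl ⟨x, hxF, rfl⟩), (x + g - rep x) + (c * (k : ℝ)) • e,
          (hL _).2 ⟨x + g - rep x, ?_, ?_, k, rfl⟩, by abel⟩
        · rw [add_sub_right_comm]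
          exact Q.lattice.add_mem (hrep x hxF).2.2 hg
        · rw [PiLp.sub_apply, hxt, (hrep x hxF).2.1, sub_self]
      · have hxF : x ∈ Ft' := (hFt' x).2 ⟨hx, hclass x hx g hg t' hxt⟩
        refine ⟨rep' x, (hmemM _).2 (Or.inr ⟨x, hxF, rfl⟩), (x + g - rep' x) + (c * (k : ℝ)) • e,
          (hL _).2 ⟨x + g - rep' x, ?_, ?_, k, rfl⟩, by abel⟩
        · rw [add_sub_right_comm]
          exact Q.lattice.add_mem (hrep' x hxF).2.2 hg
        · rw [PiLp.sub_apply, hxt, (hrep' x hxF).2.1, sub_self]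
    · rintro ⟨m, hm, l, hl, rfl⟩
      obtain ⟨g₀, hg₀, hg₀2, k, rfl⟩ := (hL l).1 hl
      obtain ⟨hmQ, hmt⟩ := hMpts m hm
      refine ⟨k, m + g₀, Q.add_mem_points hmQ hg₀, ?_, (add_assoc _ _ _).symm⟩
      rwa [PiLp.add_apply, hg₀2, add_zero]
  -- the energy formula over the transversal `M` (second presentation, `stub_pointsCongr`),
  -- then split `M` into the two disjoint injective images
  have key := restackEnergy_formula_of_transversal B V L M hne huniq hpts
  have hcard : (M.card : ℝ) = Ft.card + Ft'.card := by
    rw [hM, Finset.card_union_of_disjoint hdisj, Finset.card_image_of_injOn hinj,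
      Finset.card_image_of_injOn hinj', Nat.cast_add]
  rw [hcard] at key
  rw [key, hM, Finset.sum_union hdisj, Finset.sum_image hinj, Finset.sum_image hinj']

end Summit.AtomisticToContinuum.Crystallization.Theorems.ChessboardParticlePlanesLjPlaneChessboard

end
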